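import Literature.NumberTheory.Sieve.CircleMethod
import Literature.NumberTheory.Sieve.CircleMethodProofs
import Literature.NumberTheory.Sieve.RamanujanSum
import Mathlib.Analysis.SpecialFunctions.Integrals.Basic
import Mathlib.Analysis.Complex.Trigonometric
import Mathlib.Analysis.SpecialFunctions.Complex.Circle
import Mathlib.Analysis.SpecialFunctions.Trigonometric.Bounds
import Mathlib.MeasureTheory.Integral.IntervalIntegral.Periodic
import HarnessLib

/-!
# The unweighted exponential sum over an interval: `L²` and major-arc kernel facts

Trunk AntSieve, topic `Literature/NumberTheory/Sieve`. Elementary facts about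
`T(β) = ∑_{a < n ≤ b} e(nβ)`, the main-term kernel on a major arc in the binary circle method,
used to formalise the proof of Matomäki–Radziwiłł–Tao 2019, Prop. 3.3(i) (arXiv pp. 20–21), where
the kernel is written as `∫_X^{2X} e(βx) dx`; the sum and the integral differ by
`O(1 + |β| X)` (`norm_expSumIoc_sub_integral_le`), which is negligible on the major arcs.

## Content (all proved)

* `expSumIoc a b β = ∑_{n ∈ (a, b]} e(nβ)` for integers `a ≤ b`; for natural endpoints this is
  `Literature.linearExpSum b β - Literature.linearExpSum a β` (`expSumIoc_natCast`, `expSumIoc_zero_natCast`,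
  `expSumIoc_natCast_two_mul`), `Literature.linearExpSum N β = ∑_{1 ≤ n ≤ N} e(nβ)` being the tree's
  kernel of the singular integrals (`CircleMethod.lean`); the `ℤ` endpoints serve the dyadic
  target `(X, 2X]` (`Literature.NumberTheory.Sieve.primeExpSumDyadic`) and the shifted counts below;
* `norm_expSumIoc_le_card`: `|T(β)| ≤ b - a`;
* `norm_expSumIoc_le_inv`: `|T(β)| ≤ 1/(2|β|)` for `0 < |β| ≤ 1/2` (geometric series and Jordan's
  inequality `|sin πβ| ≥ 2|β|`), cf. MRT "the elementary bound `∫_X^{2X} e(βx) dx ≪ 1/|β|`";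
* `expSumIocSqKernel a b h β = |T(β)|² e(βh)`; `integral_expSumIocSqKernel_eq_card`,
  `integral_expSumIocSqKernel`: the orthogonality identity
  `∫_0^1 |T(β)|² e(βh) dβ = #{n ∈ (a,b] : n - h ∈ (a,b]}` and its evaluation `= b - a - |h|` for
  `|h| ≤ b - a` — the exact (sum) analogue of MRT's Fourier identity
  `∫_ℝ |∫_X^{2X} e(βx)dx|² e(βh) dβ = ∫ 1_{[X,2X]}(x) 1_{[X,2X]}(x+h) dx`;
* `norm_integral_expSumIocSqKernel_sub_le`: truncation to `|β| ≤ δ` costs at most `1/(2δ)`: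
  `|∫_{-δ}^{δ} |T(β)|² e(βh) dβ - (b - a - |h|)| ≤ 1/(2δ)` for `0 < δ ≤ 1/2` (MRT eq. (20) analogue);
* `CircleMethodKernel.norm_fourierChar_sub_le`: `|e(s) - e(t)| ≤ 2π|s - t|`, and
  `norm_expSumIoc_sub_integral_le`:
  `|T(β) - ∫_a^b e(βx) dx| ≤ 2π|β|(b - a)`.

## Design: import closure and twins elsewhere in the tree

This file keeps the light import closure of `CircleMethod.lean` (specific `Mathlib` files, no
`import Mathlib`). Three elementary facts that exist elsewhere in the topic under heavier
closures are therefore re-proved here as `private` lemmas, each docstring naming its twin: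
`norm_fourierChar_sub_one_eq` = `Literature.NumberTheory.Sieve.Vinogradov.norm_fourierChar_sub_one` and
`two_mul_abs_le_abs_sin` ⊂ `Literature.NumberTheory.Sieve.Vinogradov.two_mul_distInt_le_abs_sin`
(`VinogradovExpSumTools.lean`, `import Mathlib`), `norm_fourierChar_sub_le` =
`Literature.NumberTheory.Sieve.CircleMethodMajorArcs.norm_fourierChar_sub_fourierChar_le` (`CircleMethodMajorArcsProofs.lean`,
Bombieri–Vinogradov closure). Likewise `norm_expSumIoc_le_inv` is, for natural endpoints, a case
of `Literature.NumberTheory.Sieve.Vinogradov.norm_sum_Ioc_fourierChar_mul_distInt_le`, and `norm_expSumIoc_sub_integral_le`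
is the `ℤ`-interval companion of `Literature.NumberTheory.Sieve.CircleMethodMajorArcs.norm_sum_fourierChar_sub_integral_le`.
`e(n) = 1` is taken from the sibling file `RamanujanSum.lean` (`Literature.NumberTheory.Sieve.RamanujanSum.fourierChar_intCast`).

## References

* K. Matomäki, M. Radziwiłł, T. Tao, *Correlations of the von Mangoldt and higher divisor
  functions I*, Proc. LMS 118 (2019), proof of Prop. 3.3(i), arXiv:1707.01315 pp. 20–21, eq. (20).
* R. C. Vaughan, *The Hardy–Littlewood Method*, 2nd ed. (1997), §3.2 (the kernel `T(β)` approach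
  to the binary major arcs) and Lemma 2.8.
-/

noncomputable section

open scoped FourierTransform
open Finset MeasureTheory intervalIntegral

namespace Literature.NumberTheory.Sieve

/-! ### Definition and trivial bounds -/

/-- The unweighted exponential sum `T_{a,b}(β) = ∑_{a < n ≤ b} e(nβ)` over the integers of the
interval `(a, b]` (Vaughan, *The Hardy–Littlewood Method*, §3.2; for `(a,b] = (X,2X]` this is the
discrete form of the kernel `∫_X^{2X} e(βx) dx` of Matomäki–Radziwiłł–Tao 2019, Prop. 4.1).
[cite: VaughanHL1997, §3.2] -/
def expSumIoc (a b : ℤ) (β : ℝ) : ℂ :=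
  ∑ n ∈ Ioc a b, (𝐞 ((n : ℝ) * β) : ℂ)

/-- Unfolding lemma for `expSumIoc`. [folklore] -/
theorem expSumIoc_def (a b : ℤ) (β : ℝ) :
    expSumIoc a b β = ∑ n ∈ Ioc a b, (𝐞 ((n : ℝ) * β) : ℂ) := rfl

namespace CircleMethodKernel

/-- Product rule `e(x) e(y) = e(x + y)` for the coerced character. [folklore] -/
theorem fourierChar_coe_mul (x y : ℝ) : (𝐞 x : ℂ) * (𝐞 y : ℂ) = (𝐞 (x + y) : ℂ) := by
  rw [← Circle.coe_mul, ← AddChar.map_add_eq_mul]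

/-- `conj e(x) = e(-x)`. [folklore] -/
theorem conj_fourierChar_coe (x : ℝ) : (starRingEnd ℂ) (𝐞 x : ℂ) = (𝐞 (-x) : ℂ) := by
  rw [← Circle.coe_inv_eq_conj, AddChar.map_neg_eq_inv]

end CircleMethodKernel

open CircleMethodKernel

/-- `T` is `1`-periodic. [folklore] -/
theorem expSumIoc_add_one (a b : ℤ) (β : ℝ) : expSumIoc a b (β + 1) = expSumIoc a b β := by
  unfold expSumIoc
  refine sum_congr rfl fun n _ ↦ ?_
  rw [mul_add, mul_one, ← fourierChar_coe_mul, RamanujanSum.fourierChar_intCast, mul_one]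

/-- The trivial bound `|T_{a,b}(β)| ≤ b - a` (`a ≤ b`). [folklore] -/
theorem norm_expSumIoc_le_card {a b : ℤ} (hab : a ≤ b) (β : ℝ) :
    ‖expSumIoc a b β‖ ≤ (b - a : ℝ) := by
  unfold expSumIoc
  refine (norm_sum_le _ _).trans ?_
  simp only [Circle.norm_coe, sum_const, nsmul_eq_mul, mul_one, Int.card_Ioc]
  have : (((b - a).toNat : ℕ) : ℝ) = ((b - a : ℤ) : ℝ) := by
    exact_mod_cast Int.toNat_of_nonneg (sub_nonneg.mpr hab)
  rw [this]
  push_cast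
  exact le_rfl

/-- `T` is continuous. [folklore] -/
@[fun_prop]
theorem continuous_expSumIoc (a b : ℤ) : Continuous (expSumIoc a b) := by
  unfold expSumIoc
  fun_prop

/-! ### Bridge to `Literature.NumberTheory.Sieve.linearExpSum` -/

namespace CircleMethodKernel

/-- Casting the integer points of `(a, b] ⊆ ℕ` into `ℤ`. [folklore] -/
theorem map_natCast_Ioc (a b : ℕ) :
    (Ioc a b).map Nat.castEmbedding = Ioc (a : ℤ) (b : ℤ) := by
  ext n
  simp only [mem_map, mem_Ioc, Nat.castEmbedding_apply]
  constructor
  · rintro ⟨m, ⟨h1, h2⟩, rfl⟩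
    exact ⟨by exact_mod_cast h1, by exact_mod_cast h2⟩
  · rintro ⟨h1, h2⟩
    refine ⟨n.toNat, ⟨?_, ?_⟩, ?_⟩ <;> omega

end CircleMethodKernel

/-- **Bridge to the tree's `Literature.NumberTheory.Sieve.linearExpSum`** (`CircleMethod.lean`:
`linearExpSum N β = ∑_{1 ≤ n ≤ N} e(nβ)`, Vaughan §3.1, the kernel of `singularIntegralBinary` and
`singularIntegralTernary`): for natural endpoints `a ≤ b`,
`T_{a,b}(β) = linearExpSum b β - linearExpSum a β`. The `ℤ`-endpoint generality of `expSumIoc` is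
what the dyadic target `(X, 2X]` and the shifted count `#{n ∈ (a,b] : n - h ∈ (a,b]}` below need.
[folklore] -/
theorem expSumIoc_natCast (β : ℝ) {a b : ℕ} (hab : a ≤ b) :
    expSumIoc a b β = linearExpSum b β - linearExpSum a β := by
  have h := Finset.sum_Ioc_consecutive (fun n : ℕ ↦ (𝐞 ((n : ℝ) * β) : ℂ)) (Nat.zero_le a) hab
  have hI : ∀ N : ℕ, linearExpSum N β = ∑ n ∈ Ioc 0 N, (𝐞 ((n : ℝ) * β) : ℂ) := fun N ↦ by
    rw [linearExpSum, ← Finset.Icc_add_one_left_eq_Ioc, zero_add]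
  rw [hI, hI, ← h, add_sub_cancel_left, expSumIoc, ← map_natCast_Ioc, sum_map]
  simp only [Nat.castEmbedding_apply, Int.cast_natCast]

/-- `T_{0,N}(β) = linearExpSum N β`. [folklore] -/
theorem expSumIoc_zero_natCast (N : ℕ) (β : ℝ) : expSumIoc 0 N β = linearExpSum N β := by
  have := expSumIoc_natCast β (Nat.zero_le N)
  simp only [Nat.cast_zero] at this
  rw [this, linearExpSum, linearExpSum]
  simp

/-- The dyadic case `T_{X,2X}(β) = linearExpSum (2X) β - linearExpSum X β`, mirroring
`Literature.primeExpSumDyadic X α = S(2X, α) - S(X, α)`. [folklore] -/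
theorem expSumIoc_natCast_two_mul (X : ℕ) (β : ℝ) :
    expSumIoc X (2 * X) β = linearExpSum (2 * X) β - linearExpSum X β := by
  rw [← expSumIoc_natCast β (by omega : X ≤ 2 * X)]
  push_cast
  rfl

/-! ### The Lipschitz bound for `e` and comparison with the integral kernel -/

namespace CircleMethodKernel

/-- `|e(u) - 1| ≤ 2π|u|`. [folklore] -/
theorem norm_fourierChar_sub_one_le (u : ℝ) : ‖(𝐞 u : ℂ) - 1‖ ≤ 2 * Real.pi * |u| := by
  rw [Real.fourierChar_apply, mul_comm _ Complex.I]
  refine (Real.norm_exp_I_mul_ofReal_sub_one_le).trans (le_of_eq ?_)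
  rw [Real.norm_eq_abs, abs_mul, abs_of_pos Real.two_pi_pos]

/-- **Lipschitz bound** `|e(s) - e(t)| ≤ 2π|s - t|`. This is verbatim
`Literature.NumberTheory.Sieve.CircleMethodMajorArcs.norm_fourierChar_sub_fourierChar_le` (`CircleMethodMajorArcsProofs.lean`),
whose module is not in this file's deliberately light import closure (it imports the
Bombieri–Vinogradov reduction); kept `private` here — refactor note: both copies could become
aliases of one lemma placed next to `Literature.NumberTheory.Sieve.linearExpSum` in `CircleMethod.lean`. [folklore] -/
private theorem norm_fourierChar_sub_le (s t : ℝ) : ‖(𝐞 s : ℂ) - 𝐞 t‖ ≤ 2 * Real.pi * |s - t| := by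
  have : (𝐞 s : ℂ) - 𝐞 t = (𝐞 t : ℂ) * ((𝐞 (s - t) : ℂ) - 1) := by
    rw [mul_sub, mul_one, fourierChar_coe_mul, add_sub_cancel]
  rw [this, norm_mul, Circle.norm_coe, one_mul]
  exact norm_fourierChar_sub_one_le _

end CircleMethodKernel

/-- Reindexing `(a, b]` by `range`: `T_{a,b}(β) = ∑_{k < b-a} e((a+1+k)β)`. [folklore] -/
theorem expSumIoc_eq_sum_range (a b : ℤ) (β : ℝ) :
    expSumIoc a b β = ∑ k ∈ range (b - a).toNat, (𝐞 (((a : ℝ) + 1 + k) * β) : ℂ) := by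
  rw [expSumIoc, Int.Ioc_eq_finset_map, sum_map]
  refine sum_congr rfl fun k _ ↦ ?_
  simp only [Function.Embedding.trans_apply, Nat.castEmbedding_apply, addLeftEmbedding_apply]
  push_cast
  ring_nf

/-- **Sum versus integral kernel**: `|T_{a,b}(β) - ∫_a^b e(βx) dx| ≤ 2π|β|(b - a)` for `a ≤ b`
(each term `e(nβ)` differs from `∫_{n-1}^n e(βx) dx` by at most `2π|β|`). This bridges the
discrete kernel and the kernel `∫_X^{2X} e(βx) dx` of Matomäki–Radziwiłł–Tao 2019, Prop. 4.1.
The initial-segment form over `ℕ` (`‖∑_{n=1}^{X} e(nβ) - ∫_1^X e(βx) dx‖ ≤ 1 + 2π|β|X`) is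
`Literature.NumberTheory.Sieve.CircleMethodMajorArcs.norm_sum_fourierChar_sub_integral_le` (`CircleMethodMajorArcsProofs.lean`).
[folklore] -/
theorem norm_expSumIoc_sub_integral_le {a b : ℤ} (hab : a ≤ b) (β : ℝ) :
    ‖expSumIoc a b β - ∫ x in (a : ℝ)..b, (𝐞 (β * x) : ℂ)‖ ≤ 2 * Real.pi * |β| * (b - a) := by
  set N := (b - a).toNat with hN
  have hNba : ((N : ℕ) : ℝ) = (b : ℝ) - a := by
    have : ((N : ℕ) : ℤ) = b - a := Int.toNat_of_nonneg (sub_nonneg.mpr hab)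
    exact_mod_cast this
  -- split the integral over the unit intervals `[a+k, a+k+1]`
  have hint : ∫ x in (a : ℝ)..b, (𝐞 (β * x) : ℂ) =
      ∑ k ∈ range N, ∫ x in ((a : ℝ) + k)..((a : ℝ) + (k + 1 : ℕ)), (𝐞 (β * x) : ℂ) := by
    rw [sum_integral_adjacent_intervals (a := fun k : ℕ ↦ (a : ℝ) + k)]
    · simp [hNba]
    · intro k _
      exact (by fun_prop : Continuous fun x : ℝ ↦ (𝐞 (β * x) : ℂ)).intervalIntegrable _ _
  rw [expSumIoc_eq_sum_range, ← hN, hint, ← sum_sub_distrib]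
  calc ‖∑ k ∈ range N, ((𝐞 (((a : ℝ) + 1 + k) * β) : ℂ) -
          ∫ x in ((a : ℝ) + k)..((a : ℝ) + (k + 1 : ℕ)), (𝐞 (β * x) : ℂ))‖
      ≤ ∑ k ∈ range N, ‖(𝐞 (((a : ℝ) + 1 + k) * β) : ℂ) -
          ∫ x in ((a : ℝ) + k)..((a : ℝ) + (k + 1 : ℕ)), (𝐞 (β * x) : ℂ)‖ := norm_sum_le _ _
    _ ≤ ∑ _k ∈ range N, 2 * Real.pi * |β| := by
        refine sum_le_sum fun k _ ↦ ?_
        -- write the constant as an integral over the same unit interval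
        have hconst : (𝐞 (((a : ℝ) + 1 + k) * β) : ℂ) =
            ∫ _x in ((a : ℝ) + k)..((a : ℝ) + (k + 1 : ℕ)), (𝐞 (((a : ℝ) + 1 + k) * β) : ℂ) := by
          rw [intervalIntegral.integral_const]
          push_cast
          simp
        rw [hconst, ← intervalIntegral.integral_sub intervalIntegrable_const
          ((by fun_prop : Continuous fun x : ℝ ↦ (𝐞 (β * x) : ℂ)).intervalIntegrable _ _)]
        refine (intervalIntegral.norm_integral_le_of_norm_le_const (C := 2 * Real.pi * |β|)
          fun x hx ↦ ?_).trans ?_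
        · have hx' : (a : ℝ) + k < x ∧ x ≤ (a : ℝ) + k + 1 := by
            rw [Set.uIoc_of_le (by push_cast; linarith)] at hx
            exact ⟨hx.1, by have := hx.2; push_cast at this; linarith⟩
          refine (norm_fourierChar_sub_le _ _).trans ?_
          rw [show ((a : ℝ) + 1 + k) * β - β * x = β * ((a : ℝ) + k + 1 - x) by ring, abs_mul]
          have : |(a : ℝ) + k + 1 - x| ≤ 1 := by
            rw [abs_le]; constructor <;> linarith
          calc 2 * Real.pi * (|β| * |(a : ℝ) + k + 1 - x|) ≤ 2 * Real.pi * (|β| * 1) := by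
                gcongr
            _ = 2 * Real.pi * |β| := by ring
        · push_cast
          rw [show (a : ℝ) + (k + 1) - ((a : ℝ) + k) = 1 by ring, abs_one, mul_one]
    _ = 2 * Real.pi * |β| * (b - a) := by
        rw [sum_const, card_range, nsmul_eq_mul, hNba]
        ring

/-! ### The geometric-series bound `|T(β)| ≤ 1/(2|β|)` -/

namespace CircleMethodKernel

/-- `|e(β) - 1| = 2|sin(πβ)|`; verbatim `Literature.NumberTheory.Sieve.Vinogradov.norm_fourierChar_sub_one`
(`VinogradovExpSumTools.lean`, which `import`s all of `Mathlib` and is therefore kept out of this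
file's import closure); `private`. [folklore] -/
private theorem norm_fourierChar_sub_one_eq (β : ℝ) : ‖(𝐞 β : ℂ) - 1‖ = 2 * |Real.sin (Real.pi * β)| := by
  rw [Real.fourierChar_apply, mul_comm _ Complex.I, Complex.norm_exp_I_mul_ofReal_sub_one,
    Real.norm_eq_abs, abs_mul, abs_two, show 2 * Real.pi * β / 2 = Real.pi * β by ring]

/-- Jordan's inequality in the form `2|β| ≤ |sin(πβ)|` for `|β| ≤ 1/2`: the special case
`distInt β = |β|` of `Literature.NumberTheory.Sieve.Vinogradov.two_mul_distInt_le_abs_sin` (`VinogradovExpSumTools.lean`,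
all `x`); `private`, see `norm_fourierChar_sub_one_eq`. [folklore] -/
private theorem two_mul_abs_le_abs_sin {β : ℝ} (hβ : |β| ≤ 1 / 2) :
    2 * |β| ≤ |Real.sin (Real.pi * β)| := by
  have hpi := Real.pi_pos
  have key : ∀ γ : ℝ, 0 ≤ γ → γ ≤ 1 / 2 → 2 * γ ≤ Real.sin (Real.pi * γ) := by
    intro γ h0 h1
    have := Real.mul_le_sin (x := Real.pi * γ) (by positivity)
      (by nlinarith)
    calc 2 * γ = 2 / Real.pi * (Real.pi * γ) := by field_simp
      _ ≤ Real.sin (Real.pi * γ) := this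
  rcases le_or_gt 0 β with h | h
  · rw [abs_of_nonneg h] at hβ ⊢
    exact (key β h hβ).trans (le_abs_self _)
  · rw [abs_of_neg h] at hβ ⊢
    have := key (-β) (by linarith) hβ
    rw [mul_neg Real.pi, Real.sin_neg] at this
    exact this.trans (neg_le_abs _)

end CircleMethodKernel

/-- **Geometric-series bound**: `|T_{a,b}(β)| ≤ 1/(2|β|)` for `0 < |β| ≤ 1/2` (sum the geometric
series and use `|e(β) - 1| = 2|sin πβ| ≥ 4|β|`); the discrete form of "the elementary bound
`∫_X^{2X} e(βx) dx ≪ 1/|β|`" (Matomäki–Radziwiłł–Tao 2019, p. 20; Vaughan 1997, Lemma 2.8).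
For natural endpoints this is the case `|x| ≤ 1/2` of the tree's
`Literature.NumberTheory.Sieve.Vinogradov.norm_sum_Ioc_fourierChar_mul_distInt_le` (`VinogradovExpSumTools.lean`, Nathanson
Lemma 4.7: `|∑_{a<n≤b} e(nx)| · ‖x‖ ≤ 1/2` for all real `x`). [cite: VaughanHL1997, §3.2] -/
theorem norm_expSumIoc_le_inv {a b : ℤ} {β : ℝ} (hβ0 : β ≠ 0) (hβ : |β| ≤ 1 / 2) :
    ‖expSumIoc a b β‖ ≤ 1 / (2 * |β|) := by
  have hz1 : (𝐞 β : ℂ) ≠ 1 := by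
    intro h1
    have : ‖(𝐞 β : ℂ) - 1‖ = 0 := by rw [h1, sub_self, norm_zero]
    rw [norm_fourierChar_sub_one_eq] at this
    have h2 := two_mul_abs_le_abs_sin hβ
    have : |β| ≤ 0 := by linarith
    exact hβ0 (abs_nonpos_iff.mp this)
  have hgeom : expSumIoc a b β =
      (𝐞 (((a : ℝ) + 1) * β) : ℂ) * ∑ k ∈ range (b - a).toNat, (𝐞 β : ℂ) ^ k := by
    rw [expSumIoc_eq_sum_range, mul_sum]
    refine sum_congr rfl fun k _ ↦ ?_
    rw [← Circle.coe_pow, ← AddChar.map_nsmul_eq_pow, fourierChar_coe_mul]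
    congr 2
    rw [nsmul_eq_mul]
    ring
  rw [hgeom, norm_mul, Circle.norm_coe, one_mul, geom_sum_eq hz1, norm_div]
  have hden : 4 * |β| ≤ ‖(𝐞 β : ℂ) - 1‖ := by
    rw [norm_fourierChar_sub_one_eq]
    linarith [two_mul_abs_le_abs_sin hβ]
  have hnum : ‖(𝐞 β : ℂ) ^ (b - a).toNat - 1‖ ≤ 2 := by
    refine (norm_sub_le _ _).trans ?_
    rw [norm_pow, Circle.norm_coe, one_pow, norm_one]
    norm_num
  have hβpos : 0 < |β| := abs_pos.mpr hβ0
  rw [div_le_div_iff₀ (by linarith) (by positivity)]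
  nlinarith [norm_nonneg ((𝐞 β : ℂ) ^ (b - a).toNat - 1)]

/-- Squared form: `|T_{a,b}(β)|² ≤ 1/(4β²)` for `0 < |β| ≤ 1/2`. [folklore] -/
theorem norm_sq_expSumIoc_le {a b : ℤ} {β : ℝ} (hβ0 : β ≠ 0) (hβ : |β| ≤ 1 / 2) :
    ‖expSumIoc a b β‖ ^ 2 ≤ 1 / (4 * β ^ 2) := by
  have h := norm_expSumIoc_le_inv (a := a) (b := b) hβ0 hβ
  have hβpos : 0 < |β| := abs_pos.mpr hβ0
  calc ‖expSumIoc a b β‖ ^ 2 ≤ (1 / (2 * |β|)) ^ 2 := by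
        gcongr
    _ = 1 / (4 * β ^ 2) := by
        rw [div_pow, mul_pow, sq_abs]; norm_num

/-! ### Orthogonality: `∫_0^1 |T(β)|² e(βh) dβ` counts shifted coincidences -/

/-- The `L²`-integrand `|T(β)|² e(βh)` (real part of the major-arc main term), as a function.
[folklore] -/
def expSumIocSqKernel (a b h : ℤ) (β : ℝ) : ℂ :=
  ((‖expSumIoc a b β‖ ^ 2 : ℝ) : ℂ) * (𝐞 (β * h) : ℂ)

/-- Unfolding lemma for `expSumIocSqKernel`. [folklore] -/
theorem expSumIocSqKernel_apply (a b h : ℤ) (β : ℝ) :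
    expSumIocSqKernel a b h β = ((‖expSumIoc a b β‖ ^ 2 : ℝ) : ℂ) * (𝐞 (β * h) : ℂ) := rfl

/-- The kernel is continuous. [folklore] -/
@[fun_prop]
theorem continuous_expSumIocSqKernel (a b h : ℤ) : Continuous (expSumIocSqKernel a b h) := by
  unfold expSumIocSqKernel
  fun_prop

/-- The kernel is `1`-periodic. [folklore] -/
theorem periodic_expSumIocSqKernel (a b h : ℤ) : Function.Periodic (expSumIocSqKernel a b h) 1 := by
  intro β
  rw [expSumIocSqKernel_apply, expSumIocSqKernel_apply, expSumIoc_add_one, add_mul, one_mul,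
    ← fourierChar_coe_mul, RamanujanSum.fourierChar_intCast, mul_one]

/-- Pointwise bound `|kernel| = |T(β)|²`. [folklore] -/
theorem norm_expSumIocSqKernel (a b h : ℤ) (β : ℝ) :
    ‖expSumIocSqKernel a b h β‖ = ‖expSumIoc a b β‖ ^ 2 := by
  rw [expSumIocSqKernel_apply, norm_mul, Circle.norm_coe, mul_one, Complex.norm_real,
    Real.norm_eq_abs, abs_of_nonneg (sq_nonneg _)]

/-- Expansion of the kernel as a double exponential sum:
`|T(β)|² e(βh) = ∑_{m} ∑_{n} e((n - m + h)β)`. [folklore] -/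
theorem expSumIocSqKernel_eq_sum (a b h : ℤ) (β : ℝ) :
    expSumIocSqKernel a b h β =
      ∑ m ∈ Ioc a b, ∑ n ∈ Ioc a b, (𝐞 (((n - m + h : ℤ) : ℝ) * β) : ℂ) := by
  rw [expSumIocSqKernel_apply, Complex.ofReal_pow, ← Complex.conj_mul', expSumIoc, map_sum, sum_mul,
    sum_mul]
  refine sum_congr rfl fun m _ ↦ ?_
  rw [mul_sum, sum_mul]
  refine sum_congr rfl fun n _ ↦ ?_
  rw [conj_fourierChar_coe, fourierChar_coe_mul, fourierChar_coe_mul]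
  congr 2
  push_cast
  ring

/-- **Orthogonality count**: `∫_0^1 |T_{a,b}(β)|² e(βh) dβ = #{m ∈ (a,b] : m - h ∈ (a,b]}`
(expand and use `∫_0^1 e(kβ) dβ = [k = 0]`, `Literature.NumberTheory.Sieve.integral_fourierChar_intCast_holds`); the
discrete analogue of Matomäki–Radziwiłł–Tao's
`∫_ℝ |∫_X^{2X} e(βx) dx|² e(βh) dβ = ∫ 1_{[X,2X]}(x) 1_{[X,2X]}(x+h) dx` (2019, p. 20).
[cite: MatomakiRadziwillTao2019, §4, p. 20 (arXiv)] -/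
theorem integral_expSumIocSqKernel_eq_card (a b h : ℤ) :
    ∫ β in (0 : ℝ)..1, expSumIocSqKernel a b h β =
      (((Ioc a b).filter (fun m ↦ m - h ∈ Ioc a b)).card : ℂ) := by
  simp_rw [expSumIocSqKernel_eq_sum]
  have hii : ∀ k : ℤ, IntervalIntegrable (fun β : ℝ ↦ (𝐞 ((k : ℝ) * β) : ℂ)) volume 0 1 :=
    fun k ↦ (by fun_prop : Continuous fun β : ℝ ↦ (𝐞 ((k : ℝ) * β) : ℂ)).intervalIntegrable _ _
  rw [intervalIntegral.integral_finsetSum fun m _ ↦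
    (continuous_finsetSum _ (fun n _ ↦ by fun_prop)).intervalIntegrable _ _]
  rw [sum_congr rfl fun m _ ↦ intervalIntegral.integral_finsetSum fun n _ ↦ hii _]
  have horth : ∀ k : ℤ, ∫ α in (0 : ℝ)..1, (𝐞 (k * α) : ℂ) = if k = 0 then 1 else 0 :=
    integral_fourierChar_intCast_holds
  simp_rw [horth]
  -- `∑_m ∑_n [n - m + h = 0] = #{m : m - h ∈ (a,b]}`
  rw [card_eq_sum_ones, Nat.cast_sum, sum_filter]
  push_cast
  refine sum_congr rfl fun m _ ↦ ?_
  have hiff : ∀ n : ℤ, (n - m + h = 0) ↔ (m - h = n) := fun n ↦ by omega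
  simp_rw [hiff, sum_ite_eq]

namespace CircleMethodKernel

/-- The coincidence count: for `|h| ≤ b - a`, `#{m ∈ (a,b] : m - h ∈ (a,b]} = b - a - |h|`.
[folklore] -/
theorem card_filter_sub_mem_Ioc {a b h : ℤ} (hh : |h| ≤ b - a) :
    ((((Ioc a b).filter (fun m ↦ m - h ∈ Ioc a b)).card : ℕ) : ℤ) = b - a - |h| := by
  have hset : (Ioc a b).filter (fun m ↦ m - h ∈ Ioc a b) = Ioc (max a (a + h)) (min b (b + h)) := by
    ext m
    simp only [mem_filter, mem_Ioc, max_lt_iff, le_min_iff]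
    omega
  rw [hset, Int.card_Ioc]
  have hab : |h| ≤ b - a := hh
  rcases le_or_gt 0 h with h0 | h0
  · rw [abs_of_nonneg h0] at hab ⊢
    rw [max_eq_right (by linarith), min_eq_left (by linarith), Int.toNat_of_nonneg (by linarith)]
    ring
  · rw [abs_of_neg h0] at hab ⊢
    rw [max_eq_left (by linarith), min_eq_right (by linarith), Int.toNat_of_nonneg (by linarith)]
    ring

end CircleMethodKernel

/-- **Evaluation**: `∫_0^1 |T_{a,b}(β)|² e(βh) dβ = b - a - |h|` for `|h| ≤ b - a`. [folklore] -/
theorem integral_expSumIocSqKernel {a b h : ℤ} (hh : |h| ≤ b - a) :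
    ∫ β in (0 : ℝ)..1, expSumIocSqKernel a b h β = ((b - a - |h| : ℤ) : ℂ) := by
  rw [integral_expSumIocSqKernel_eq_card, ← card_filter_sub_mem_Ioc hh]
  norm_cast

/-- By periodicity the same holds over `[-1/2, 1/2]`. [folklore] -/
theorem integral_expSumIocSqKernel_symm {a b h : ℤ} (hh : |h| ≤ b - a) :
    ∫ β in (-(1 / 2) : ℝ)..(1 / 2), expSumIocSqKernel a b h β = ((b - a - |h| : ℤ) : ℂ) := by
  have := (periodic_expSumIocSqKernel a b h).intervalIntegral_add_eq (-(1 / 2)) 0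
  rw [zero_add, show (-(1 / 2) : ℝ) + 1 = 1 / 2 by norm_num] at this
  rw [this, integral_expSumIocSqKernel hh]

/-! ### Truncation to `|β| ≤ δ` -/

/-- `∫_δ^{1/2} dβ/(4β²) = (1/δ - 2)/4 ≤ 1/(4δ)` and the tail bound it implies:
`∫_δ^{1/2} |T(β)|² dβ ≤ 1/(4δ)` for `0 < δ ≤ 1/2`. [folklore] -/
theorem integral_norm_sq_expSumIoc_tail_le {a b : ℤ} {δ : ℝ} (hδ : 0 < δ) (hδ' : δ ≤ 1 / 2) :
    ∫ β in δ..(1 / 2), ‖expSumIoc a b β‖ ^ 2 ≤ 1 / (4 * δ) := by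
  have hmono : ∫ β in δ..(1 / 2), ‖expSumIoc a b β‖ ^ 2 ≤ ∫ β in δ..(1 / 2), 1 / (4 * β ^ 2) := by
    refine intervalIntegral.integral_mono_on hδ' ?_ ?_ fun β hβ ↦ ?_
    · exact ((continuous_expSumIoc a b).norm.pow 2).intervalIntegrable _ _
    · refine ContinuousOn.intervalIntegrable_of_Icc hδ' (continuousOn_of_forall_continuousAt ?_)
      intro β hβ
      have : β ≠ 0 := ne_of_gt (lt_of_lt_of_le hδ hβ.1)
      fun_prop (disch := positivity)
    · have hβ0 : β ≠ 0 := ne_of_gt (lt_of_lt_of_le hδ hβ.1)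
      exact norm_sq_expSumIoc_le hβ0 (by rw [abs_of_pos (by linarith [hβ.1])]; exact hβ.2)
  refine hmono.trans ?_
  have hcalc : ∫ β in δ..(1 / 2), 1 / (4 * β ^ 2) = (1 / δ - 2) / 4 := by
    have h0 : (0 : ℝ) ∉ Set.uIcc δ (1 / 2) := by
      rw [Set.uIcc_of_le hδ']
      intro h0
      exact absurd h0.1 (not_le.mpr hδ)
    have := integral_zpow (a := δ) (b := 1 / 2) (n := -2) (Or.inr ⟨by norm_num, h0⟩)
    have hrw : (fun β : ℝ ↦ 1 / (4 * β ^ 2)) = fun β : ℝ ↦ (1 / 4 : ℝ) * β ^ (-2 : ℤ) := by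
      funext β
      rw [zpow_neg, zpow_ofNat]
      ring
    rw [hrw, intervalIntegral.integral_const_mul, this]
    norm_num
    field_simp
    ring
  rw [hcalc]
  have : 0 < 1 / δ := by positivity
  rw [div_le_div_iff₀ (by norm_num) (by positivity)]
  field_simp
  nlinarith

/-- The mirror-image tail `∫_{-1/2}^{-δ} |T(β)|² dβ ≤ 1/(4δ)`. [folklore] -/
theorem integral_norm_sq_expSumIoc_tail_le' {a b : ℤ} {δ : ℝ} (hδ : 0 < δ) (hδ' : δ ≤ 1 / 2) :
    ∫ β in (-(1 / 2))..(-δ), ‖expSumIoc a b β‖ ^ 2 ≤ 1 / (4 * δ) := by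
  have hsymm : ∀ β : ℝ, ‖expSumIoc a b (-β)‖ = ‖expSumIoc a b β‖ := by
    intro β
    rw [← Complex.norm_conj (expSumIoc a b β), expSumIoc, expSumIoc, map_sum]
    congr 1
    refine sum_congr rfl fun n _ ↦ ?_
    rw [conj_fourierChar_coe, mul_neg]
  have : ∫ β in (-(1 / 2))..(-δ), ‖expSumIoc a b β‖ ^ 2 =
      ∫ β in δ..(1 / 2), ‖expSumIoc a b β‖ ^ 2 := by
    calc ∫ β in (-(1 / 2))..(-δ), ‖expSumIoc a b β‖ ^ 2
        = ∫ β in (-(1 / 2))..(-δ), ‖expSumIoc a b (-β)‖ ^ 2 :=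
          intervalIntegral.integral_congr fun β _ ↦ by simp only [hsymm]
      _ = ∫ β in δ..(1 / 2), ‖expSumIoc a b β‖ ^ 2 := by
          rw [intervalIntegral.integral_comp_neg (fun β ↦ ‖expSumIoc a b β‖ ^ 2)]
          norm_num
  rw [this]
  exact integral_norm_sq_expSumIoc_tail_le hδ hδ'

/-- **Truncated orthogonality** (discrete analogue of Matomäki–Radziwiłł–Tao 2019, eq. (20):
"`∫_{|β| ≤ X^{-1} log^{B'} X} |∫_X^{2X} e(βx) dx|² e(βh) dβ = (1 + O(log^{-B'} X)) X`"): for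
`|h| ≤ b - a` and `0 < δ ≤ 1/2`,
`|∫_{-δ}^{δ} |T_{a,b}(β)|² e(βh) dβ - (b - a - |h|)| ≤ 1/(2δ)`.
[cite: MatomakiRadziwillTao2019, §4 eq. (20), p. 20 (arXiv)] -/
theorem norm_integral_expSumIocSqKernel_sub_le {a b h : ℤ} (hh : |h| ≤ b - a) {δ : ℝ}
    (hδ : 0 < δ) (hδ' : δ ≤ 1 / 2) :
    ‖(∫ β in (-δ)..δ, expSumIocSqKernel a b h β) - ((b - a - |h| : ℤ) : ℂ)‖ ≤ 1 / (2 * δ) := by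
  have hii : ∀ u v : ℝ, IntervalIntegrable (expSumIocSqKernel a b h) volume u v :=
    fun u v ↦ (continuous_expSumIocSqKernel a b h).intervalIntegrable _ _
  rw [← integral_expSumIocSqKernel_symm hh,
    ← integral_add_adjacent_intervals (hii (-(1 / 2)) (-δ)) (hii (-δ) (1 / 2)),
    ← integral_add_adjacent_intervals (hii (-δ) δ) (hii δ (1 / 2))]
  have h1 : ‖∫ β in δ..(1 / 2), expSumIocSqKernel a b h β‖ ≤ 1 / (4 * δ) := by
    refine (intervalIntegral.norm_integral_le_integral_norm hδ').trans ?_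
    rw [intervalIntegral.integral_congr (g := fun β ↦ ‖expSumIoc a b β‖ ^ 2)
      (fun β _ ↦ norm_expSumIocSqKernel a b h β)]
    exact integral_norm_sq_expSumIoc_tail_le hδ hδ'
  have h2 : ‖∫ β in (-(1 / 2))..(-δ), expSumIocSqKernel a b h β‖ ≤ 1 / (4 * δ) := by
    refine (intervalIntegral.norm_integral_le_integral_norm (by linarith)).trans ?_
    rw [intervalIntegral.integral_congr (g := fun β ↦ ‖expSumIoc a b β‖ ^ 2)
      (fun β _ ↦ norm_expSumIocSqKernel a b h β)]
    exact integral_norm_sq_expSumIoc_tail_le' hδ hδ'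
  calc ‖(∫ β in (-δ)..δ, expSumIocSqKernel a b h β) -
        ((∫ β in (-(1 / 2))..(-δ), expSumIocSqKernel a b h β) +
          ((∫ β in (-δ)..δ, expSumIocSqKernel a b h β) +
            ∫ β in δ..(1 / 2), expSumIocSqKernel a b h β))‖
      = ‖(∫ β in (-(1 / 2))..(-δ), expSumIocSqKernel a b h β) +
          ∫ β in δ..(1 / 2), expSumIocSqKernel a b h β‖ := by
        rw [← norm_neg]
        congr 1
        ring
    _ ≤ 1 / (4 * δ) + 1 / (4 * δ) := (norm_add_le _ _).trans (add_le_add h2 h1)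
    _ = 1 / (2 * δ) := by
        field_simp
        ring

end Literature.NumberTheory.Sieve

end
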